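import HarnessLib.Audit.LibrarySuggestionsDenyListCorCM
import Summits.HodgeConjecture.HodgeConjecture.Theorems.F0D6CmCurveBody
import Literature.NumberTheory.Automorphic.Liu2021.AppendixC.RecordCurveCorD9OfEichlerShimura
import Literature.NumberTheory.Automorphic.Liu2021.AppendixC.EtaleH1TowerHeckePinGeometric
import Literature.AlgebraicGeometry.Motives.AbelianVarietyEichlerShimuraPinTransport
import Literature.AlgebraicGeometry.Motives.AbelianVarietyEndPointwiseFrobenius
import Literature.AlgebraicGeometry.Motives.AbelianSchemeModelTateSpecialisationFamily
import Literature.NumberTheory.DiophantineGeometry.AbelianSchemeModelGeneratesSpecialFibre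
import Literature.NumberTheory.Automorphic.Liu2021.AlbaneseGenerates
import Literature.AlgebraicGeometry.ShimuraVarieties.UnitaryShimuraCurveRecordEmpty
import Literature.AlgebraicGeometry.Motives.AlgPointsNonempty
import Literature.AlgebraicGeometry.Motives.IntegralModelReductionMap
import Literature.AlgebraicGeometry.Motives.IntegralModelTensorReductionMap
import Literature.AlgebraicGeometry.Motives.IntegralModelReductionMapAbelianScheme
import Literature.NumberTheory.Automorphic.Liu2021.AppendixC.EichlerShimuraPointwiseAssembly
import Literature.NumberTheory.Automorphic.Liu2021.NablaMapGeometricPointsLift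
import Literature.NumberTheory.Automorphic.Liu2021.AppendixC.AlbaneseTraceLevelQuotient
import Mathlib.AlgebraicGeometry.Morphisms.Flat
import Literature.AlgebraicGeometry.Motives.IntegralModelReductionMapSurjective
import Literature.AlgebraicGeometry.Motives.IntegralModelReductionMapFrobenius
import Literature.NumberTheory.Automorphic.Liu2021.AppendixC.NablaReductionSeparates
import Literature.NumberTheory.Automorphic.Liu2021.AppendixC.EichlerShimuraPointwiseOfCongruence
import Literature.AlgebraicGeometry.Motives.AbelianVarietyGoodReductionCofinite
import Literature.NumberTheory.DiophantineGeometry.AbelianSchemeModelNeronExtension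
import Mathlib.AlgebraicGeometry.Morphisms.Finite
import Literature.AlgebraicGeometry.Motives.IntegralModelSpecialFibrePointsOver
import Literature.AlgebraicGeometry.Motives.IntegralModelTwoSectionFibreIdentity
import Literature.AlgebraicGeometry.Motives.IntegralModelTwoSectionPushforward
import Literature.AlgebraicGeometry.Motives.SepQuotientIntermediateFibres
import Literature.NumberTheory.Automorphic.UnitaryGroupHeckeDegreeSplitPlace
import Literature.NumberTheory.Automorphic.UnitaryGroupHeckeCentralElement
import Literature.NumberTheory.Automorphic.UnitaryGroupHeckeCosetLevelChange
import Literature.AlgebraicGeometry.Motives.IntegralModelReductionMultisetPushforward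
import Literature.NumberTheory.Automorphic.Liu2021.AppendixC.SmallLevelTrace
import Literature.NumberTheory.Automorphic.Liu2021.AppendixC.RestOneLevelInvariants
import Literature.NumberTheory.Automorphic.Liu2021.AppendixC.BettiPinningHeckeEndomorphism
import Literature.NumberTheory.Automorphic.HeckeAlgebra
import Literature.AlgebraicGeometry.ShimuraVarieties.UnitaryShimuraCurveHeckeHolds
import Literature.AlgebraicGeometry.ShimuraVarieties.UnitaryShimuraCurveRecordTorsionFree
import Literature.AlgebraicGeometry.ShimuraVarieties.UnitaryShimuraCurveLevelFibres
import Literature.AlgebraicGeometry.Motives.SepQuotientIntermediateFibreMultiplicity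
import Literature.AlgebraicGeometry.Motives.AlgPointsCoincidenceLocusTransfer
import Literature.NumberTheory.Automorphic.Liu2021.AppendixC.SmallLevelInfConj
import Literature.GroupTheory.Index.ConjugateIntersectionIndex

/-!
# `F0D9opRoad2Body` — ★ RE-HOME (rung-0 re-homing task, books INVENTORY §8.4 M-3; LEAD F0P6-plan (g4) «M-72») of the crux workfile `Lines/F0D9opRoad2Body.lean`

**SIZE-LINT SPLIT ×4** (`Theorems/` files with proofs are ≤ 400 lines): parts `Theorems/F0D9opRoad2BodyLetters.lean` → `Theorems/F0D9opRoad2BodyDesk.lean` → `Theorems/F0D9opRoad2BodyGamma.lean` → `Theorems/F0D9opRoad2Body.lean`, each importing the previous, cut at declaration boundaries of `Lines/F0D9opRoad2Body.lean`; namespaces AND sections KEPT and re-opened per part (with their `open`∕`variable` lines replayed verbatim); the options preamble is repeated. This is PART 1.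

This `Theorems/` module is the TREE BYTES of `Summits/HodgeConjecture/HodgeConjecture/Cruxes/HLiu418/Lines/F0D9opRoad2Body.lean` (edition of record,
tree sha16 10fde182f554a82a, 1121 l., code-`sorry`-free) with the NAMESPACE KEPT — `Summit.HodgeConjecture.HodgeConjecture.Cruxes.HLiu418.F0D9opRoad2` — so that every
fully-qualified name (`RecordCurveEichlerShimura`, `RecordCurveEichlerShimuraModel`, `RecordCurveEichlerShimuraHonest`, `RecordCurveNonempty`, `stub_N`, `of`, `RecordCurveEichlerShimuraPointwise`, `ProperFlatModelReductionSurjective`, `stub_H`, `RecordCurveCongruenceOnPoints`, …; 25 declarations) is UNCHANGED; only this module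
docstring is re-headed and the `Lines` imports are switched to their ★ re-homed twins (`D6CmCurveBody` → `Theorems.F0D6CmCurveBody`).  Why a re-home: a `Theorems/` file cannot import a `Lines/` workfile (F0P6-ref1 o-6), and closing
stmt-HodgeConjecture-24832 `--as proved --by <Theorems decl>` at rung 0 needs the sorry-free Lines chain behind the gate (RE-HOME MAP v1.1, LA7-plan (g4),
2026-09-02; director g27 s1336 (R1)–(R3)).    Lines importers of the original: `F0D9opRoad2Mod`, `F0_D9opRoad2`, `F0_P6a_PointwiseFrobenius`.
After this file is ★ the Lines workfile is meant to become a one-import SHIM of it (a `Lines/` write, batched per cone on the LEAD's word), so no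
environment ever holds two copies (NO-CROSS-IMPORT rule, «M-72» (3)).  It asserts nothing beyond what the workfile already proves.

## Original module docstring (verbatim)
## SUB-LINE `Cruxes/HLiu418/Lines/F0-D9opRoad2` — the registered `stub_D9op : CorD9OnMOp CMgsm XMgsm` of the d6 line
(crux item stmt-HodgeConjecture-24832, registry `Lines/d6_cm_curve.lean` :93) from ONE special-fibre letter (road 2′)

FLOOR 0 (D-0183), PLAN v1.4 §P5, pole D9op.  Card: `Lines/F0-D9opRoad2.md` (registrar A-plan2 (g16), draft v0 f6021397).  Letters of record:
A-p06 (g17) `A-provers/A-p06/g17/F0P5/D9op-SUBLINE-LETTERS.v0.2.A-p06g17.md` 754697d1 (L0–L5); by-name census A-p14 (g14) ad4b327d;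
L4 = ★ `Literature.NumberTheory.Automorphic.Liu2021.AppendixC.RecordCurveCorD9OfEichlerShimura` (A-p14 (g14) PL4, head
`Sec42Data.HeckeTranslates.towerRep_quadratic_of_redEnd`); L0∕L1∕L2 ★; L5 + composition here (A-p05 (g15)).  EDITION 4 (F0P5a LEAD WORDS #7–#10, ED4-CUT-LETTER §8, F0P5a-p02 (g0) hand-back memo, 2026-08-31): the pole `stub_C` is now a THEOREM (`stub_C_of`) over SIX letters — `stub_H : ProperFlatModelReductionSurjective` (★ p796981), `stub_C1b : RecordCurveAlbaneseTrace` (★ p795546), `stub_C3 : letter_D8_heckeReductionPointwise` (= `RecordCurveCongruenceOnPoints`, THE BOUNDARY: the printed congruence on points, [Liu2021] D.8), `stub_U : RecordNablaTrSurjective` (★ p795322), `stub_π0 : SmoothProperModelSeparatesNabla` (★ p796906), `stub_Fr : FrobeniusLiftOnReduction` (★ p796419) — all but `stub_C3` DISCHARGED by name; the composition is ★ `Sec42Data.HeckeTranslates.eichlerShimura_pointwise_of_congruence` (F0P5a-p05 (g0)) instantiated at the record datum.  ONE live stub: `stub_C3`.  EDITION 3 (F0P5a LEAD WORD #3∕#4,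 PLAN-F0P5a v1 §4 + box (e), 2026-08-30): `stub_L3a` is now a THEOREM over the pole `stub_C : RecordCurveEichlerShimuraPointwise`
(POINTWISE «ES·π» over the CONCRETE Néron reduction of the Albanese difference morphism) and the (now ★-discharged, p793292) `stub_N : RecordCurveNonempty`; generation ★
`Albanese.generates_α` (p792901), spread ★ `AbelianSchemeModelGeneratesSpecialFibre` (p792583), transport ★ `AbelianVarietyEndPointwiseFrobenius`. EDITION 2 (F0P5a LEAD WORD #1∕#3, 2026-08-30): the edition-1 stub `stub_L3` is now a THEOREM over the edition-2 stub
`stub_L3a : RecordCurveEichlerShimuraHonest` (level-`K` trace currency, V-free «ES·π» form; transport ★ A-L3-5 + ★ `AbelianVarietyEichlerShimuraPinTransport`). Edition-1 text: ONE registered stub: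
`stub_L3 : RecordCurveEichlerShimuraModel` (∃-a-model form; the `∀ R` form `RecordCurveEichlerShimura` implies it) — the Eichler–Shimura congruence relation for `Alb(M⋆_K)` at a split hyperspecial place, `m`-cleared
two-denominator form ([Liu2021] Prop. D.8 + proof of Cor. D.9 p. 139; [Carayol1986Compositio] §10.3).  HEAD: `stub_D9op_holds : CorD9OnMOp CMgsm XMgsm`
BY NAME (token-equal to 2∕3′ :814 ∕ 3∕3′ :93), via the kernel-checked `D9op_of_L3`.
HC_CM is proved only modulo the 7 printed citations until rung 0 closes. -/


namespace Summit.HodgeConjecture.HodgeConjecture.Cruxes.HLiu418.F0D9opRoad2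

set_option linter.dupNamespace false  -- `Summit.HodgeConjecture.HodgeConjecture.…` BY DESIGN (D-0017), as in `Lines/d6_cm_curve.lean`

open CategoryTheory NumberField IsDedekindDomain MulAction
open scoped Matrix MonObj CategoryTheory.Obj
open MonoidalCategory
open Summit.HodgeConjecture.CorCM.Lines.A3Liu418
open Literature.AlgebraicGeometry.Motives (AbelianVariety)
open Literature.AlgebraicGeometry.Motives.AbelianVariety (rationalTateModuleMap frobeniusHom zsmul_eq_zsmul_trace_comp_of_pin
  exists_finite_forall_exists_goodReductionAt_homReduction_tateSpecialisation)
open Literature.NumberTheory.GaloisRepresentations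
open Literature.NumberTheory.Automorphic Literature.NumberTheory.Automorphic.UnitaryGroup
open Literature.AlgebraicGeometry.ShimuraVarieties.UnitaryCanonicalModel
open Literature.NumberTheory.Automorphic.Liu2021.AppendixC
open Literature.AlgebraicGeometry.Motives (AlgPoints IntegralModel frobeniusOver SchemeOver)
open Literature.NumberTheory.DiophantineGeometry (geomResidueField)

/-! ### The letter L3 and the ONE registered stub -/

/-- **LETTER L3 — `RecordCurveEichlerShimura`** (the pole of road 2′; A-p06 (g17) v0.2 §2 L3 in the registered letter՚s own vocabulary): for every
record datum `(F, ι₁, J⋆, K₀, S, hU7ₛ, hLQ, h4, isoₛ, hJ, hJu)` and small level `K` there is a finite set `S₃(K)` of finite places of `F` such that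
at every place `w ∉ S₃(K)` SPLIT over `F⁺` (`c • w ≠ w`) with `J⋆_w ∈ GL₂(𝒪_w)` and `K` hyperspecial at `w⁺`, for every prime `ℓ` WITH `w ∤ ℓ` (the composition only consumes such `ℓ`; so the prover may work `ℓ`-adically on the
special fibre, `T_ℓ Ā_K` being faithful on `End Ā_K` for `ℓ ≠ char κ(w)`), every pair of L0-PINS `(θᵢ, mᵢ)` of the spherical Hecke operators `T_{w,i} = [K tw_i K]` (`mᵢ ≠ 0`, `[ᵗV_ℓ(θᵢ) φ]_K = mᵢ • T_{w,i} [φ]_K` for all `φ`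
— the ∃-body of ★ `exists_hom_toTower_dualMap_eq_smul_heckeOperator` at `heckeElementAt … i`) and every good-reduction datum `R` of
`A_K = Alb(M⋆_K)` at `w`: `m₁m₂•π² − m₂•θ̄₁π + (m₁·N w)•θ̄₂ = 0` in `End Ā_K` (`π := frobeniusHom Ā_K`, `θ̄ᵢ := R.redEnd θᵢ`,
`N w := Ideal.absNorm w`).  Informally: the Eichler–Shimura congruence relation `π² − T_{w,1} π + (N w) T_{w,2} = 0` on the reduction of the
unitary Shimura CURVE `M⋆_K` at a split hyperspecial place, read in `End Ā_K` through the Albanese and the Hecke dictionary — exactly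
what [Liu2021] proves «on `T_K`» below Cor. D.9 (p. 139 L3–L31: Prop. D.8 (1)–(3), `T = T⁺ ∪ T⁻`, `π⁺` iso, `π⁻` finite flat of degree `q`,
`(π⁻ ⊗ 1)(t ⊗ σ)(π⁺ ⊗ 1)⁻¹ = Frob_q`), cf. [Carayol1986Compositio] §10.3.  DEGREE-1 HOMOGENEOUS in `(θ₁, m₁)` and in `(θ₂, m₂)` separately (REF1
m24).  NOT asserted here: the registered stub below.
(print: Liu2021, Prop. D.8 (1)–(3) and Cor. D.9 with proof (FJcycle.tex l. 5579–5600; print pp. 135–139)) (print: Carayol1986Compositio, §10.3 p. 210) -/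
def RecordCurveEichlerShimura : Prop :=
  ∀ (F : Type) [Field F] [NumberField F] [IsCMField F] [IsGalois ℚ F] (ι₁ : F →+* ℂ)
    (Jstar : Matrix (Fin 2) (Fin 2) F)
    (K₀ : C5.OpenCompactSubgroup ↥(finAdelic ↥(maximalRealSubfield F) F (IsCMField.complexConj F) 2 Jstar))
    (S : RecordSystemGS F Jstar ι₁ K₀) (hU7ₛ : S.HeckeTranslateDefinedOver) (hLQ : S.IsLevelQuotient)
    (h4 : 4 ≤ Module.finrank ℚ F) (isoₛ : ℕ → Prop)
    (hJ : (Jstar.map (IsCMField.complexConj F))ᵀ = Jstar) (hJu : IsUnit Jstar) (K : C5.SmallLevel K₀),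
    ∃ S₃ : Set (HeightOneSpectrum (𝓞 F)), S₃.Finite ∧
      ∀ w : HeightOneSpectrum (𝓞 F), w ∉ S₃ → ∀ hw : (IsCMField.complexConj F) • w ≠ w,
        (UnitaryGroup.isUnit_placeForm Jstar hJu w).unit ∈ glInt 2 (w.adicCompletion F) →
          UnitaryGroup.IsHyperspecialAt ↥(maximalRealSubfield F) F (IsCMField.complexConj F) 2 Jstar K.1.1
            (w.under (𝓞 ↥(maximalRealSubfield F))) →
          ∀ (ℓ : ℕ) [Fact ℓ.Prime], ((ℓ : ℕ) : 𝓞 F) ∉ w.asIdeal →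
          ∀ (θ₁ θ₂ : End ((CMgsm F ι₁ Jstar K₀ S h4 isoₛ).A K)) (m₁ m₂ : ℤ), m₁ ≠ 0 → m₂ ≠ 0 →
            (∀ φ : (CMgsm F ι₁ Jstar K₀ S h4 isoₛ).etaleH1 ℓ K,
              (CMgsm F ι₁ Jstar K₀ S h4 isoₛ).toTower ℓ K ((rationalTateModuleMap ℓ (θ₁ : _ ⟶ _)).dualMap φ) =
                (m₁ : ℚ_[ℓ]) • heckeOperator ((Literature.NumberTheory.Automorphic.Liu2021.AppendixC.sec42HeckeTranslatesGSM S hU7ₛ h4 isoₛ).etHeckeRep ℓ) (K.1.1 : Subgroup _)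
                  (UnitaryGroup.heckeElementAt ↥(maximalRealSubfield F) F (IsCMField.complexConj F) 2 Jstar
                    (⟨w, rfl⟩ : UnitaryGroup.PlacesOver F (w.under (𝓞 ↥(maximalRealSubfield F))))
                    (IsCMField.complexConj_ne_one F) hJ hw (UnitaryGroup.isUnit_placeForm Jstar hJu w) (HeckeCharacter.uniformizer F w) 1)
                  ((CMgsm F ι₁ Jstar K₀ S h4 isoₛ).toTower ℓ K φ)) →
            (∀ φ : (CMgsm F ι₁ Jstar K₀ S h4 isoₛ).etaleH1 ℓ K,
              (CMgsm F ι₁ Jstar K₀ S h4 isoₛ).toTower ℓ K ((rationalTateModuleMap ℓ (θ₂ : _ ⟶ _)).dualMap φ) =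
                (m₂ : ℚ_[ℓ]) • heckeOperator ((Literature.NumberTheory.Automorphic.Liu2021.AppendixC.sec42HeckeTranslatesGSM S hU7ₛ h4 isoₛ).etHeckeRep ℓ) (K.1.1 : Subgroup _)
                  (UnitaryGroup.heckeElementAt ↥(maximalRealSubfield F) F (IsCMField.complexConj F) 2 Jstar
                    (⟨w, rfl⟩ : UnitaryGroup.PlacesOver F (w.under (𝓞 ↥(maximalRealSubfield F))))
                    (IsCMField.complexConj_ne_one F) hJ hw (UnitaryGroup.isUnit_placeForm Jstar hJu w) (HeckeCharacter.uniformizer F w) 2)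
                  ((CMgsm F ι₁ Jstar K₀ S h4 isoₛ).toTower ℓ K φ)) →
            ∀ R : ((CMgsm F ι₁ Jstar K₀ S h4 isoₛ).A K).GoodReductionAt w,
              (m₁ * m₂) • (End.of (frobeniusHom R.reduction) * End.of (frobeniusHom R.reduction))
                - m₂ • (R.redEnd θ₁ * End.of (frobeniusHom R.reduction))
                + (m₁ * (Ideal.absNorm w.asIdeal : ℤ)) • R.redEnd θ₂ = 0

/-- **LETTER L3, MODEL FORM — `RecordCurveEichlerShimuraModel`** (the SAME congruence relation, stated for a good-reduction datum of the PROVER՚s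
choice): at every split hyperspecial `w ∉ S₃(K)` there EXISTS a good-reduction datum `R` of `A_K = Alb(M⋆_K)` at `w` admitting an `ℓ`-adic
specialisation for every `ℓ` with `w ∤ ℓ` (★ `IsAbelianSchemeModel.goodReductionAt` ∕ `.tateSpecialisation` provide both from ANY abelian-scheme
model — e.g. the Albanese of the smooth integral model of `M⋆_K`), such that for every `ℓ` with `w ∤ ℓ` and every pair of L0-pins `(θᵢ, mᵢ)` the identity
`m₁m₂•π² − m₂•θ̄₁π + (m₁·N w)•θ̄₂ = 0` holds in `End R.reduction`.  WEAKER than `RecordCurveEichlerShimura` (`∀ R`) off a finite set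
(`recordCurveEichlerShimuraModel_of_forall`, via ★ L1) and WITHOUT the transport-between-models burden flagged by the census §5 (P3); the
composition `D9op_of_L3` below consumes this form (then L1 is not even needed).
(print: Liu2021, Prop. D.8 (1)–(3) and Cor. D.9 with proof (FJcycle.tex l. 5579–5600)) (print: Carayol1986Compositio, §10.3 p. 210) -/
def RecordCurveEichlerShimuraModel : Prop :=
  ∀ (F : Type) [Field F] [NumberField F] [IsCMField F] [IsGalois ℚ F] (ι₁ : F →+* ℂ)
    (Jstar : Matrix (Fin 2) (Fin 2) F)
    (K₀ : C5.OpenCompactSubgroup ↥(finAdelic ↥(maximalRealSubfield F) F (IsCMField.complexConj F) 2 Jstar))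
    (S : RecordSystemGS F Jstar ι₁ K₀) (hU7ₛ : S.HeckeTranslateDefinedOver) (hLQ : S.IsLevelQuotient)
    (h4 : 4 ≤ Module.finrank ℚ F) (isoₛ : ℕ → Prop)
    (hJ : (Jstar.map (IsCMField.complexConj F))ᵀ = Jstar) (hJu : IsUnit Jstar) (K : C5.SmallLevel K₀),
    ∃ S₃ : Set (HeightOneSpectrum (𝓞 F)), S₃.Finite ∧
      ∀ w : HeightOneSpectrum (𝓞 F), w ∉ S₃ → ∀ hw : (IsCMField.complexConj F) • w ≠ w,
        (UnitaryGroup.isUnit_placeForm Jstar hJu w).unit ∈ glInt 2 (w.adicCompletion F) →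
          UnitaryGroup.IsHyperspecialAt ↥(maximalRealSubfield F) F (IsCMField.complexConj F) 2 Jstar K.1.1
            (w.under (𝓞 ↥(maximalRealSubfield F))) →
          ∃ R : ((CMgsm F ι₁ Jstar K₀ S h4 isoₛ).A K).GoodReductionAt w,
           (∀ (ℓ : ℕ) [Fact ℓ.Prime], ((ℓ : ℕ) : 𝓞 F) ∉ w.asIdeal → Nonempty (R.TateSpecialisation ℓ)) ∧
           ∀ (ℓ : ℕ) [Fact ℓ.Prime], ((ℓ : ℕ) : 𝓞 F) ∉ w.asIdeal →
           ∀ (θ₁ θ₂ : End ((CMgsm F ι₁ Jstar K₀ S h4 isoₛ).A K)) (m₁ m₂ : ℤ), m₁ ≠ 0 → m₂ ≠ 0 →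
            (∀ φ : (CMgsm F ι₁ Jstar K₀ S h4 isoₛ).etaleH1 ℓ K,
              (CMgsm F ι₁ Jstar K₀ S h4 isoₛ).toTower ℓ K ((rationalTateModuleMap ℓ (θ₁ : _ ⟶ _)).dualMap φ) =
                (m₁ : ℚ_[ℓ]) • heckeOperator ((Literature.NumberTheory.Automorphic.Liu2021.AppendixC.sec42HeckeTranslatesGSM S hU7ₛ h4 isoₛ).etHeckeRep ℓ) (K.1.1 : Subgroup _)
                  (UnitaryGroup.heckeElementAt ↥(maximalRealSubfield F) F (IsCMField.complexConj F) 2 Jstar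
                    (⟨w, rfl⟩ : UnitaryGroup.PlacesOver F (w.under (𝓞 ↥(maximalRealSubfield F))))
                    (IsCMField.complexConj_ne_one F) hJ hw (UnitaryGroup.isUnit_placeForm Jstar hJu w) (HeckeCharacter.uniformizer F w) 1)
                  ((CMgsm F ι₁ Jstar K₀ S h4 isoₛ).toTower ℓ K φ)) →
            (∀ φ : (CMgsm F ι₁ Jstar K₀ S h4 isoₛ).etaleH1 ℓ K,
              (CMgsm F ι₁ Jstar K₀ S h4 isoₛ).toTower ℓ K ((rationalTateModuleMap ℓ (θ₂ : _ ⟶ _)).dualMap φ) =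
                (m₂ : ℚ_[ℓ]) • heckeOperator ((Literature.NumberTheory.Automorphic.Liu2021.AppendixC.sec42HeckeTranslatesGSM S hU7ₛ h4 isoₛ).etHeckeRep ℓ) (K.1.1 : Subgroup _)
                  (UnitaryGroup.heckeElementAt ↥(maximalRealSubfield F) F (IsCMField.complexConj F) 2 Jstar
                    (⟨w, rfl⟩ : UnitaryGroup.PlacesOver F (w.under (𝓞 ↥(maximalRealSubfield F))))
                    (IsCMField.complexConj_ne_one F) hJ hw (UnitaryGroup.isUnit_placeForm Jstar hJu w) (HeckeCharacter.uniformizer F w) 2)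
                  ((CMgsm F ι₁ Jstar K₀ S h4 isoₛ).toTower ℓ K φ)) →
              (m₁ * m₂) • (End.of (frobeniusHom R.reduction) * End.of (frobeniusHom R.reduction))
                - m₂ • (R.redEnd θ₁ * End.of (frobeniusHom R.reduction))
                + (m₁ * (Ideal.absNorm w.asIdeal : ℤ)) • R.redEnd θ₂ = 0

/-! ### The letter L3a (the pole) and the ONE registered stub (edition 2: replaces `stub_L3`) -/

/-- **LETTER L3a — `RecordCurveEichlerShimuraHonest`** (the Eichler–Shimura congruence relation for the HONEST Hecke correspondences of the
record curve, «ES·π» form).  For every record datum and small level `K` there is a finite `S₃(K)` such that at every split hyperspecial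
`w ∉ S₃(K)` with `J⋆_w ∈ GL₂(𝒪_w)` SOME good-reduction datum `R` of the level-`K` Albanese `A_K = Alb(M⋆_K)` (with `ℓ`-adic specialisations
for all `ℓ`, `w ∤ ℓ` — for the geometry: the `Pic⁰`∕Albanese of the smooth integral model `S_K` of [Liu2021] D.8 (1)) satisfies: for EVERY
small level `N ⊆ K` normalised by `K` and all representatives `rᵢ α` of the cosets `αK ⊆ K twᵢ K` (`tw₁ = diag(ϖ,1)`, `tw₂ = diag(ϖ,ϖ)` at `w`)
with the translates `T_{rᵢ α} : M⋆_N → M⋆_K` defined, there EXIST an integer `d ≠ 0` and a homomorphism `t : A_K → A_N` with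
`t ≫ Alb(u^N_K) = d • 𝟙` (the Albanese trace of the Galois covering `u^N_K`, `d = [K:N]`, [Lang1983AbelianVarieties] VIII §6 Thm. 13,
★ `Albanese.exists_trace_comp_eq_card_smul_of_isSepQuotient`) such that the trace-scaled honest correspondences
`𝒯ᵢ := t ≫ Σ_α Alb(T_{rᵢ α}) ∈ End(A_K)` (`= d ·` the Hecke correspondence `T_{w,i}` on `Alb(M⋆_K)`; `𝒯₂ = d · ⟨ϖ⟩`) reduce to
  `𝒯̄₁ · π = d • π² + (N w) • 𝒯̄₂`   in `End R.reduction`   (`π := frobeniusHom`, `𝒯̄ᵢ := R.redEnd 𝒯ᵢ`, `N w := Ideal.absNorm w`; in `End`, `x * π` = `π` FIRST),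
i.e. print՚s `T̃_𝔭 = F + ⟨ϖ⟩ V` ([DiamondShurman2005] Thm. 8.7.2, [Shimura1971] (7.4.1)–(7.4.3), [Liu2021] D.8 (3) + p. 139:
`T = T⁺ ∪ T⁻`, `π⁺` iso, `π⁻` purely inseparable of degree `q`) times `d`, right-multiplied by `π` using `V π = q` — the Verschiebung `V`
(Frobenius pull-back on `Pic⁰` of the special fibre) lives inside the pole՚s geometry and is NOT part of this letter (the tree has no abstract
Verschiebung; no extra citation enters the D9op path).  ∀ over `(N, rᵢ)` (the geometry holds for every admissible normal `N`; the transport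
below picks the `N` of the pins), ∃ over `(d, t)` (no rogue trace: A-p06 (g17) 21:39Z (iii)).  WHY IT SUFFICES: `stub_L3_holds` below.
NOT asserted here: the registered stub `stub_L3a`.
(print: Liu2021, Prop. D.8 (1)–(3) and Cor. D.9 with proof (FJcycle.tex l. 5579–5600; print pp. 135–139)) (print: DiamondShurman2005, Thm. 8.7.2 (p. 353))
(print: Shimura1971, §7.4 (7.4.1)–(7.4.3)) (print: Lang1983AbelianVarieties, Ch. VIII §6 Thm. 13 (pp. 224–227)) -/
def RecordCurveEichlerShimuraHonest : Prop :=
  ∀ (F : Type) [Field F] [NumberField F] [IsCMField F] [IsGalois ℚ F] (ι₁ : F →+* ℂ)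
    (Jstar : Matrix (Fin 2) (Fin 2) F)
    (K₀ : C5.OpenCompactSubgroup ↥(finAdelic ↥(maximalRealSubfield F) F (IsCMField.complexConj F) 2 Jstar))
    (S : RecordSystemGS F Jstar ι₁ K₀) (hU7ₛ : S.HeckeTranslateDefinedOver) (hLQ : S.IsLevelQuotient)
    (h4 : 4 ≤ Module.finrank ℚ F) (isoₛ : ℕ → Prop)
    (hJ : (Jstar.map (IsCMField.complexConj F))ᵀ = Jstar) (hJu : IsUnit Jstar) (K : C5.SmallLevel K₀),
    ∃ S₃ : Set (HeightOneSpectrum (𝓞 F)), S₃.Finite ∧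
      ∀ w : HeightOneSpectrum (𝓞 F), w ∉ S₃ → ∀ hw : (IsCMField.complexConj F) • w ≠ w,
        (UnitaryGroup.isUnit_placeForm Jstar hJu w).unit ∈ glInt 2 (w.adicCompletion F) →
          UnitaryGroup.IsHyperspecialAt ↥(maximalRealSubfield F) F (IsCMField.complexConj F) 2 Jstar K.1.1
            (w.under (𝓞 ↥(maximalRealSubfield F))) →
          ∃ R : ((CMgsm F ι₁ Jstar K₀ S h4 isoₛ).A K).GoodReductionAt w,
           (∀ (ℓ : ℕ) [Fact ℓ.Prime], ((ℓ : ℕ) : 𝓞 F) ∉ w.asIdeal → Nonempty (R.TateSpecialisation ℓ)) ∧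
           ∀ (N : C5.SmallLevel K₀) (hNK : N ≤ K), (∀ k ∈ K.1.1, C5.HeckeLE k N N) →
           ∀ (r₁ : orbit (K.1.1 : Subgroup (CMgsm F ι₁ Jstar K₀ S h4 isoₛ).G)
                  ((UnitaryGroup.heckeElementAt ↥(maximalRealSubfield F) F (IsCMField.complexConj F) 2 Jstar
                      (⟨w, rfl⟩ : UnitaryGroup.PlacesOver F (w.under (𝓞 ↥(maximalRealSubfield F))))
                      (IsCMField.complexConj_ne_one F) hJ hw (UnitaryGroup.isUnit_placeForm Jstar hJu w) (HeckeCharacter.uniformizer F w) 1 :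
                    (CMgsm F ι₁ Jstar K₀ S h4 isoₛ).G) : (CMgsm F ι₁ Jstar K₀ S h4 isoₛ).G ⧸ (K.1.1 : Subgroup (CMgsm F ι₁ Jstar K₀ S h4 isoₛ).G)) →
                (CMgsm F ι₁ Jstar K₀ S h4 isoₛ).G),
             (∀ α, ((r₁ α : (CMgsm F ι₁ Jstar K₀ S h4 isoₛ).G) : (CMgsm F ι₁ Jstar K₀ S h4 isoₛ).G ⧸ (K.1.1 : Subgroup (CMgsm F ι₁ Jstar K₀ S h4 isoₛ).G)) = α.1) →
             ∀ (hrN₁ : ∀ α, C5.HeckeLE (r₁ α) N K)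
               (r₂ : orbit (K.1.1 : Subgroup (CMgsm F ι₁ Jstar K₀ S h4 isoₛ).G)
                  ((UnitaryGroup.heckeElementAt ↥(maximalRealSubfield F) F (IsCMField.complexConj F) 2 Jstar
                      (⟨w, rfl⟩ : UnitaryGroup.PlacesOver F (w.under (𝓞 ↥(maximalRealSubfield F))))
                      (IsCMField.complexConj_ne_one F) hJ hw (UnitaryGroup.isUnit_placeForm Jstar hJu w) (HeckeCharacter.uniformizer F w) 2 :
                    (CMgsm F ι₁ Jstar K₀ S h4 isoₛ).G) : (CMgsm F ι₁ Jstar K₀ S h4 isoₛ).G ⧸ (K.1.1 : Subgroup (CMgsm F ι₁ Jstar K₀ S h4 isoₛ).G)) →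
                (CMgsm F ι₁ Jstar K₀ S h4 isoₛ).G),
             (∀ α, ((r₂ α : (CMgsm F ι₁ Jstar K₀ S h4 isoₛ).G) : (CMgsm F ι₁ Jstar K₀ S h4 isoₛ).G ⧸ (K.1.1 : Subgroup (CMgsm F ι₁ Jstar K₀ S h4 isoₛ).G)) = α.1) →
             ∀ (hrN₂ : ∀ α, C5.HeckeLE (r₂ α) N K),
             ∃ (d : ℤ) (t : (CMgsm F ι₁ Jstar K₀ S h4 isoₛ).A K ⟶ (CMgsm F ι₁ Jstar K₀ S h4 isoₛ).A N), d ≠ 0 ∧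
               t ≫ (CMgsm F ι₁ Jstar K₀ S h4 isoₛ).Atr (homOfLE hNK) = d • 𝟙 ((CMgsm F ι₁ Jstar K₀ S h4 isoₛ).A K) ∧
               R.redEnd (t ≫ ∑ᶠ α, (Literature.NumberTheory.Automorphic.Liu2021.AppendixC.sec42HeckeTranslatesGSM S hU7ₛ h4 isoₛ).albTr (r₁ α) N K (hrN₁ α))
                   * End.of (frobeniusHom R.reduction) =
                 d • (End.of (frobeniusHom R.reduction) * End.of (frobeniusHom R.reduction)) +
                 (Ideal.absNorm w.asIdeal : ℤ) •
                   R.redEnd (t ≫ ∑ᶠ α, (Literature.NumberTheory.Automorphic.Liu2021.AppendixC.sec42HeckeTranslatesGSM S hU7ₛ h4 isoₛ).albTr (r₂ α) N K (hrN₂ α))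

/-! ### Edition 3: the pole in POINTWISE form over the CONCRETE Néron reduction of the Albanese difference morphism (ONE registered stub: `stub_C`; `stub_N` is ★) -/

/-- **LETTER N — `RecordCurveNonempty`** (S-sized side input of the generation step): the record curve `M⋆_K` is a NON-EMPTY scheme
(its complex points are the double-coset Shimura set `ShimuraSetGS F J⋆ ι₁ K` through the record՚s uniformisation `pts`, [Liu2021] §C.3 ∕ (F2);
a negative vector for `J⋆` at `ι₁` exists by the signature condition of the record).  Needed because ★ `Albanese.generates_α` (F0P5a-p01 (g0),
p792901) carries `[Nonempty X.left]` — the desked `AlbDiffGenerates` was FALSE at `X = ∅` (F0P5a-p01 22:28Z).  NOT asserted here: `stub_N`.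
(print: Liu2021, App. C Def. C.8 and (F2) (FJcycle.tex l. 4656–4660)) -/
def RecordCurveNonempty : Prop :=
  ∀ (F : Type) [Field F] [NumberField F] [IsCMField F] (ι₁ : F →+* ℂ) (Jstar : Matrix (Fin 2) (Fin 2) F)
    (K₀ : C5.OpenCompactSubgroup ↥(finAdelic ↥(maximalRealSubfield F) F (IsCMField.complexConj F) 2 Jstar))
    (S : RecordSystemGS F Jstar ι₁ K₀) (h4 : 4 ≤ Module.finrank ℚ F) (isoₛ : ℕ → Prop) (K : C5.SmallLevel K₀),
    Nonempty ((CMgsm F ι₁ Jstar K₀ S h4 isoₛ).X K).left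

/-- **`stub_N : RecordCurveNonempty` — DISCHARGED** (inline, A-plan2 (g16) probe 0e631231; the same statement is ★ p793292
`RecordSystemGS.nonempty_obj_left`, F0P5a-p01 (g0)): a negative vector at `ι₁` exists by the record itself (★ `RecordSystemGS.negCone_nonempty`), its class
under the uniformisation `pts` is a complex point, and a scheme with a complex point is non-empty (★ `nonempty_left_of_nonempty_complexPoints`);
`(CMgsm …).X K = S.M.obj K` by `rfl`. [cite: Liu2021, App. C (F2) (FJcycle.tex l. 4656–4660)] -/
theorem stub_N : RecordCurveNonempty := by
  intro F _ _ _ ι₁ Jstar K₀ S h4 isoₛ K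
  letI : Algebra F ℂ := ι₁.toAlgebra
  obtain ⟨v, hv⟩ := S.negCone_nonempty
  exact Literature.AlgebraicGeometry.Motives.nonempty_left_of_nonempty_complexPoints _
    ⟨(S.pts K).symm (ShimuraSetGS.mk F Jstar ι₁ K.1.1 v hv 1)⟩

/-- **LETTER C — `RecordCurveEichlerShimuraPointwise`** (THE POLE in pointwise form over the CONCRETE Néron reduction; F0P5a LEAD WORD #3∕#4,
F0P5a-plan PLAN v1 §4 + box (e) ruling 22:16Z, F0P5a-p02 census c2cf9400∕bbe595f5 §2 C\*, T3′ desk (2)).  For every record datum and small `K`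
there is a finite `S₃(K)` such that at every split hyperspecial `w ∉ S₃(K)` with `J⋆_w ∈ GL₂(𝒪_w)` there EXIST: an abelian-scheme model `𝒜` of
`A_K = Alb(M⋆_K)` at `w` (★ `IsAbelianSchemeModel`; its produced good-reduction datum ★ `IsAbelianSchemeModel.goodReductionAt` has reduction the
special fibre `𝒜_w` and `ℓ`-adic specialisations ★ `IsAbelianSchemeModel.tateSpecialisation` for all `ℓ`, `w ∤ ℓ`), a smooth proper model `𝒮` of the
curve `M⋆_K` over `𝒪_{F,(w)}` ([Liu2021] D.8 (1) at hyperspecial level; ★ `exists_finite_hasGoodReductionOutside_holds` off a finite set), an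
`F`-morphism `αd : M⋆_K × M⋆_K → A_K` restricting to the Albanese morphism `α_K` on `∇M⋆_K` (the extension by `1` off the open-and-closed `∇M⋆_K`,
★ `exists_desc_eq_one_of_isClopen`), and an `𝒪_{F,(w)}`-morphism `𝔞 : 𝒮 × 𝒮 → 𝒜` whose generic fibre, read through the cartesian-monoidal
structure of the generic-fibre functor, `𝒮.genericIso` and the model՚s `e : 𝒜_F ≅ A_K`, is `αd` (the NÉRON EXTENSION, T3′ desk (2); ★
`IsNeronModel.mappingProperty` of ★ `isNeronModel_of_isAbelianSchemeModel`), such that for every small `N ⊆ K` normalised by `K` and all coset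
representatives `rᵢ α` of `K twᵢ K ∕ K` with the translates defined there are `d ≠ 0` and `t : A_K → A_N` with `t ≫ Alb(u^N_K) = d • 𝟙` for
which, for EVERY geometric point `z` of the special fibre `(𝒮 × 𝒮)_w`, in the group `𝒜_w(κ(w)^{alg})`:
  `𝒯̄₁(ᾱ(F z)) = d • ᾱ(F² z) + (N w) • 𝒯̄₂(ᾱ(z))`,
`ᾱ := (𝒮 × 𝒮)_w → 𝒜_w` the special fibre of `𝔞`, `F` the `q`-Frobenius of `(𝒮 × 𝒮)_w` (★ `frobeniusOver`), `𝒯̄ᵢ := (𝒯ᵢ)~` the reduction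
(★ `IsAbelianSchemeModel.specialFibreHom` = `(goodReductionAt h).redEnd`, by `rfl`) of the trace-scaled honest correspondence
`𝒯ᵢ := t ≫ Σ_α Alb(T_{rᵢ α}) ∈ End(A_K)`; the middle term is spelled `geomPointsMap (𝟙 _) (…)` (the identity of `𝒜_w(κ^{alg})`, ★ `geomPointsMap_id`)
only to fix the additive type.  This is print՚s «`T̄(F x) = F² x + q·⟨ϖ⟩ x` as 0-cycles on `T_K`» ([Liu2021] p. 139 L4–L10 with D.8 (3);
[DiamondShurman2005] Thm. 8.7.2; [Shimura1971] (7.4.1)–(7.4.3)), `d`-scaled and read on the special fibre of the Albanese through the difference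
points `ᾱ(x, y)` — no Verschiebung, no `Alb(T_K)`, no relative `Pic⁰`.  WHY IT SUFFICES: `recordCurveEichlerShimuraHonest_of_pointwise` below
(★ `Albanese.generates_α` (F0P5a-p01, p792901) ⇒ `αd`, hence the generic fibre of `𝔞`, generates `A_K` — ★ `Generates.of_comp`; generation spreads to the special fibre — ★
`IsAbelianSchemeModel.generates_specialFibreFunctor_map`; then ★ `AbelianVariety.mul_frobeniusHom_eq_of_forall_geomPoints`).  NOT asserted here:
the registered stub `stub_C`.
(print: Liu2021, Prop. D.8 (1)–(3) and Cor. D.9 with proof (FJcycle.tex l. 5579–5600; print pp. 135–139)) (print: Lang1983AbelianVarieties, II §3 (p. 40))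
(print: DiamondShurman2005, Thm. 8.7.2 (p. 353)) (print: Shimura1971, §7.4 (7.4.1)–(7.4.3)) (print: BombieriGubler2006, 10.3.9 (p. 334)) -/
def RecordCurveEichlerShimuraPointwise : Prop :=
  ∀ (F : Type) [Field F] [NumberField F] [IsCMField F] [IsGalois ℚ F] (ι₁ : F →+* ℂ)
    (Jstar : Matrix (Fin 2) (Fin 2) F)
    (K₀ : C5.OpenCompactSubgroup ↥(finAdelic ↥(maximalRealSubfield F) F (IsCMField.complexConj F) 2 Jstar))
    (S : RecordSystemGS F Jstar ι₁ K₀) (hU7ₛ : S.HeckeTranslateDefinedOver) (hLQ : S.IsLevelQuotient)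
    (h4 : 4 ≤ Module.finrank ℚ F) (isoₛ : ℕ → Prop)
    (hJ : (Jstar.map (IsCMField.complexConj F))ᵀ = Jstar) (hJu : IsUnit Jstar) (K : C5.SmallLevel K₀),
    ∃ S₃ : Set (HeightOneSpectrum (𝓞 F)), S₃.Finite ∧
      ∀ w : HeightOneSpectrum (𝓞 F), w ∉ S₃ → ∀ hw : (IsCMField.complexConj F) • w ≠ w,
        (UnitaryGroup.isUnit_placeForm Jstar hJu w).unit ∈ glInt 2 (w.adicCompletion F) →
          UnitaryGroup.IsHyperspecialAt ↥(maximalRealSubfield F) F (IsCMField.complexConj F) 2 Jstar K.1.1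
            (w.under (𝓞 ↥(maximalRealSubfield F))) →
          ∃ (𝒜 : Literature.AlgebraicGeometry.Motives.SchemeOver (HeightOneSpectrum.valuationSubringAtPrime F w)) (_ : GrpObj 𝒜)
            (h : Literature.NumberTheory.DiophantineGeometry.IsAbelianSchemeModel ((CMgsm F ι₁ Jstar K₀ S h4 isoₛ).A K) w 𝒜)
            (𝒮 : Literature.AlgebraicGeometry.Motives.IntegralModel (HeightOneSpectrum.valuationSubringAtPrime F w) F ((CMgsm F ι₁ Jstar K₀ S h4 isoₛ).X K))
            (_ : 𝒮.IsSmoothProper 1)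
            (αd : (CMgsm F ι₁ Jstar K₀ S h4 isoₛ).X K ⊗ (CMgsm F ι₁ Jstar K₀ S h4 isoₛ).X K ⟶ ((CMgsm F ι₁ Jstar K₀ S h4 isoₛ).A K).X)
            (_ : ((CMgsm F ι₁ Jstar K₀ S h4 isoₛ).alb K).nabla.incl ≫ αd = ((CMgsm F ι₁ Jstar K₀ S h4 isoₛ).alb K).α)
            (𝔞 : 𝒮.total ⊗ 𝒮.total ⟶ 𝒜)
            (_ : Functor.LaxMonoidal.μ (Literature.NumberTheory.EllipticCurves.genericFibre (HeightOneSpectrum.valuationSubringAtPrime F w) F) 𝒮.total 𝒮.total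
                  ≫ (Literature.NumberTheory.EllipticCurves.genericFibre (HeightOneSpectrum.valuationSubringAtPrime F w) F).map 𝔞 ≫ h.exists_iso.choose.hom
                = (𝒮.genericIso.hom ⊗ₘ 𝒮.genericIso.hom) ≫ αd),
           ∀ (N : C5.SmallLevel K₀) (hNK : N ≤ K), (∀ k ∈ K.1.1, C5.HeckeLE k N N) →
           ∀ (r₁ : orbit (K.1.1 : Subgroup (CMgsm F ι₁ Jstar K₀ S h4 isoₛ).G)
                  ((UnitaryGroup.heckeElementAt ↥(maximalRealSubfield F) F (IsCMField.complexConj F) 2 Jstar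
                      (⟨w, rfl⟩ : UnitaryGroup.PlacesOver F (w.under (𝓞 ↥(maximalRealSubfield F))))
                      (IsCMField.complexConj_ne_one F) hJ hw (UnitaryGroup.isUnit_placeForm Jstar hJu w) (HeckeCharacter.uniformizer F w) 1 :
                    (CMgsm F ι₁ Jstar K₀ S h4 isoₛ).G) : (CMgsm F ι₁ Jstar K₀ S h4 isoₛ).G ⧸ (K.1.1 : Subgroup (CMgsm F ι₁ Jstar K₀ S h4 isoₛ).G)) →
                (CMgsm F ι₁ Jstar K₀ S h4 isoₛ).G),
             (∀ α, ((r₁ α : (CMgsm F ι₁ Jstar K₀ S h4 isoₛ).G) : (CMgsm F ι₁ Jstar K₀ S h4 isoₛ).G ⧸ (K.1.1 : Subgroup (CMgsm F ι₁ Jstar K₀ S h4 isoₛ).G)) = α.1) →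
             ∀ (hrN₁ : ∀ α, C5.HeckeLE (r₁ α) N K)
               (r₂ : orbit (K.1.1 : Subgroup (CMgsm F ι₁ Jstar K₀ S h4 isoₛ).G)
                  ((UnitaryGroup.heckeElementAt ↥(maximalRealSubfield F) F (IsCMField.complexConj F) 2 Jstar
                      (⟨w, rfl⟩ : UnitaryGroup.PlacesOver F (w.under (𝓞 ↥(maximalRealSubfield F))))
                      (IsCMField.complexConj_ne_one F) hJ hw (UnitaryGroup.isUnit_placeForm Jstar hJu w) (HeckeCharacter.uniformizer F w) 2 :
                    (CMgsm F ι₁ Jstar K₀ S h4 isoₛ).G) : (CMgsm F ι₁ Jstar K₀ S h4 isoₛ).G ⧸ (K.1.1 : Subgroup (CMgsm F ι₁ Jstar K₀ S h4 isoₛ).G)) →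
                (CMgsm F ι₁ Jstar K₀ S h4 isoₛ).G),
             (∀ α, ((r₂ α : (CMgsm F ι₁ Jstar K₀ S h4 isoₛ).G) : (CMgsm F ι₁ Jstar K₀ S h4 isoₛ).G ⧸ (K.1.1 : Subgroup (CMgsm F ι₁ Jstar K₀ S h4 isoₛ).G)) = α.1) →
             ∀ (hrN₂ : ∀ α, C5.HeckeLE (r₂ α) N K),
             ∃ (d : ℤ) (t : (CMgsm F ι₁ Jstar K₀ S h4 isoₛ).A K ⟶ (CMgsm F ι₁ Jstar K₀ S h4 isoₛ).A N), d ≠ 0 ∧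
               t ≫ (CMgsm F ι₁ Jstar K₀ S h4 isoₛ).Atr (homOfLE hNK) = d • 𝟙 ((CMgsm F ι₁ Jstar K₀ S h4 isoₛ).A K) ∧
               ∀ z : Literature.AlgebraicGeometry.Motives.AlgPoints
                   ((Literature.NumberTheory.DiophantineGeometry.specialFibreFunctor w).obj (𝒮.total ⊗ 𝒮.total)) (AlgebraicClosure w.asIdeal.ResidueField),
                 AbelianVariety.Hom.geomPointsMap
                     (h.specialFibreHom h (t ≫ ∑ᶠ α, (Literature.NumberTheory.Automorphic.Liu2021.AppendixC.sec42HeckeTranslatesGSM S hU7ₛ h4 isoₛ).albTr (r₁ α) N K (hrN₁ α)))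
                     (Additive.ofMul (Literature.AlgebraicGeometry.Motives.AlgPoints.map ((Literature.NumberTheory.DiophantineGeometry.specialFibreFunctor w).map 𝔞)
                       (Literature.AlgebraicGeometry.Motives.AlgPoints.map (Literature.AlgebraicGeometry.Motives.frobeniusOver _) z))) =
                   d • AbelianVariety.Hom.geomPointsMap (𝟙 h.specialFibre)
                     (Additive.ofMul (Literature.AlgebraicGeometry.Motives.AlgPoints.map ((Literature.NumberTheory.DiophantineGeometry.specialFibreFunctor w).map 𝔞)
                       (Literature.AlgebraicGeometry.Motives.AlgPoints.map (Literature.AlgebraicGeometry.Motives.frobeniusOver _)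
                         (Literature.AlgebraicGeometry.Motives.AlgPoints.map (Literature.AlgebraicGeometry.Motives.frobeniusOver _) z)))) +
                   (Ideal.absNorm w.asIdeal : ℤ) • AbelianVariety.Hom.geomPointsMap
                     (h.specialFibreHom h (t ≫ ∑ᶠ α, (Literature.NumberTheory.Automorphic.Liu2021.AppendixC.sec42HeckeTranslatesGSM S hU7ₛ h4 isoₛ).albTr (r₂ α) N K (hrN₂ α)))
                     (Additive.ofMul (Literature.AlgebraicGeometry.Motives.AlgPoints.map ((Literature.NumberTheory.DiophantineGeometry.specialFibreFunctor w).map 𝔞) z))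

end Summit.HodgeConjecture.HodgeConjecture.Cruxes.HLiu418.F0D9opRoad2
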